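import Mathlib
import Summits.PneNP.PneNP.Theorems.OverlapGapAlgebraSolvableImpliesStableSectionDensityLiftHoeffding

/-!
# PneNP / OverlapGapAlgebra — crux `SolvableImpliesStableSection` (stmt-PneNP-2463):
# the DENSITY LIFT block (2/4) — splice points of a lifted section: head, tail rows, the tail event

Support for crux `stmt-PneNP-2463` (`Summit.PneNP.PneNP.Theses.OverlapGapAlgebra.SolvableImpliesStableSection`).
The pieces of the lift `g Φ := G (first m' clauses of Φ)` of a map `G` on `m'`-clause instances to
`m`-clause instances (`m ≥ m'`), at one splice point `(r, q)` of a Bresler–Huang path tuple: restricting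
the splice point to its first `m'` rows IS the splice point of the restricted tuple (same splice
formula), and past the head (`q ≥ m'k`) it is the restriction of the later endpoint
(`sissDL_head_splice_of_ge`); the tail rows `a ≥ m'` are, apart from at most one straddling row
(`sissDL_card_straddle_le_one`), whole rows of the tuple (`sissDL_splice_row`) not read by `g`, so the
conditional Hoeffding bound `sissDL_card_violTail_paths_le` controls how many of them `g` violates
(`sissDL_card_bad_le`), and off that tail event the splice point has at most
`V' + 1 + 2^{-k}(m - m') + t` violated rows (`sissDL_viol_le`).  The product structure
`#{Ψ : head tuple ∈ S}·#paths' = #S·#paths` is `sissDL_card_headGood`.  Assembled in `sissDL_count`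
(file `…DensityLiftCount`).

* `sissDL_card_headGood` — the product structure;
* `sissDL_card_bad_le` — the tail event at one splice point (registered);
* `sissDL_viol_le` — validity of the lifted section at one splice point off the tail event.
No definitions; axioms `propext`, `Classical.choice`, `Quot.sound`.
-/

set_option linter.dupNamespace false -- `Summit.PneNP.PneNP.…`: summit = sub-problem (D-0017)

namespace Summit.PneNP.PneNP.Theorems

open Finset
open scoped Classical

section DensityLiftPath

variable {k m m' n : ℕ}

/-- A non-straddling row of a splice point is a whole row of the tuple. -/
theorem sissDL_splice_row (Ψ : Fin (k + 1) → Fin m → Fin k → Fin n × Bool) (r : Fin k) (q : ℕ)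
    (a : Fin m) (ha : ((a : ℕ) + 1) * k ≤ q ∨ q ≤ (a : ℕ) * k) :
    (fun b : Fin k => if (a : ℕ) * k + b < q then Ψ r.succ a b else Ψ r.castSucc a b) =
      Ψ (if ((a : ℕ) + 1) * k ≤ q then r.succ else r.castSucc) a := by
  funext b
  by_cases h1 : ((a : ℕ) + 1) * k ≤ q
  · have hlt : (a : ℕ) * k + b < q := by
      have hb := b.isLt
      calc (a : ℕ) * k + b < (a : ℕ) * k + k := by omega
        _ = ((a : ℕ) + 1) * k := by ring
        _ ≤ q := h1
    rw [if_pos hlt, if_pos h1]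
  · have h2 : q ≤ (a : ℕ) * k := by tauto
    have hnlt : ¬ ((a : ℕ) * k + b < q) := by omega
    rw [if_neg hnlt, if_neg h1]

/-- At most one row straddles a splice point. -/
theorem sissDL_card_straddle_le_one (q : ℕ) :
    ((univ : Finset (Fin m)).filter fun a : Fin m =>
      ¬ (((a : ℕ) + 1) * k ≤ q ∨ q ≤ (a : ℕ) * k)).card ≤ 1 := by
  refine Finset.card_le_one.2 fun a ha a' ha' => ?_
  rw [mem_filter] at ha ha'
  push Not at ha ha'
  obtain ⟨h1, h2⟩ := ha.2
  obtain ⟨h1', h2'⟩ := ha'.2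
  have e1 : (a : ℕ) < (a' : ℕ) + 1 := Nat.lt_of_mul_lt_mul_right (h2.trans h1')
  have e2 : (a' : ℕ) < (a : ℕ) + 1 := Nat.lt_of_mul_lt_mul_right (h2'.trans h1)
  exact Fin.ext (by omega)

/-- Head rows are filled in at every splice point past the head: for `q ≥ m'k` the restriction of
the splice point to the first `m'` rows is the restriction of the later endpoint. -/
theorem sissDL_head_splice_of_ge (hm : m' ≤ m) (Ψ : Fin (k + 1) → Fin m → Fin k → Fin n × Bool)
    (r : Fin k) (q : ℕ) (hq : m' * k ≤ q) :
    (fun (a' : Fin m') (b : Fin k) => if (a' : ℕ) * k + b < q then Ψ r.succ (Fin.castLE hm a') b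
      else Ψ r.castSucc (Fin.castLE hm a') b) = fun a' => Ψ r.succ (Fin.castLE hm a') := by
  funext a' b
  have hlt : (a' : ℕ) * k + b < q := by
    have ha' := a'.isLt
    have hb := b.isLt
    have h1 : ((a' : ℕ) + 1) * k ≤ m' * k := Nat.mul_le_mul_right k ha'
    calc (a' : ℕ) * k + b < (a' : ℕ) * k + k := by omega
      _ = ((a' : ℕ) + 1) * k := by ring
      _ ≤ q := h1.trans hq
  rw [if_pos hlt]

/-- **Product structure.** The number of path tuples (with `m` rows) whose head tuple (first `m'`
rows) lies in a set `S`, times `#paths'`, is `#S · #paths`. -/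
theorem sissDL_card_headGood (hm : m' ≤ m)
    (S : Finset (Fin (k + 1) → Fin m' → Fin k → Fin n × Bool)) :
    ((((univ : Finset (Fin (k + 1) → Fin m → Fin k → Fin n × Bool)).filter fun Ψ =>
        (fun ρ a' => Ψ ρ (Fin.castLE hm a')) ∈ S).card : ℕ) *
        Fintype.card (Fin (k + 1) → Fin m' → Fin k → Fin n × Bool)) =
      S.card * Fintype.card (Fin (k + 1) → Fin m → Fin k → Fin n × Bool) := by
  -- the product decomposition `paths ≃ paths' × tails`
  obtain ⟨e, he⟩ : ∃ e : (Fin (k + 1) → Fin m → Fin k → Fin n × Bool) ≃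
      (Fin (k + 1) → Fin m' → Fin k → Fin n × Bool) ×
        (Fin (k + 1) → {a : Fin m // ¬ (a : ℕ) < m'} → Fin k → Fin n × Bool),
      ∀ Ψ, (e Ψ).1 = fun ρ a' => Ψ ρ (Fin.castLE hm a') := by
    refine ⟨{ toFun := fun Ψ => (fun ρ a' => Ψ ρ (Fin.castLE hm a'), fun ρ a => Ψ ρ a.1)
              invFun := fun x ρ a => if h : (a : ℕ) < m' then x.1 ρ ⟨a, h⟩ else x.2 ρ ⟨a, h⟩
              left_inv := fun Ψ => ?_
              right_inv := fun x => ?_ }, fun Ψ => rfl⟩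
    · funext ρ a
      by_cases h : (a : ℕ) < m'
      · simp only [dif_pos h]; rfl
      · simp only [dif_neg h]
    · obtain ⟨x₁, x₂⟩ := x
      simp only [Prod.mk.injEq]
      refine ⟨?_, ?_⟩
      · funext ρ a'
        have h : ((Fin.castLE hm a' : Fin m) : ℕ) < m' := a'.isLt
        simp only [dif_pos h]; rfl
      · funext ρ a
        simp only [dif_neg a.2]
  -- `#paths = #paths' · #tails`
  have hcard : Fintype.card (Fin (k + 1) → Fin m → Fin k → Fin n × Bool) =
      Fintype.card (Fin (k + 1) → Fin m' → Fin k → Fin n × Bool) *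
        Fintype.card (Fin (k + 1) → {a : Fin m // ¬ (a : ℕ) < m'} → Fin k → Fin n × Bool) := by
    rw [Fintype.card_congr e, Fintype.card_prod]
  -- `#{head ∈ S} = #S · #tails`
  have hfil : ((univ : Finset (Fin (k + 1) → Fin m → Fin k → Fin n × Bool)).filter fun Ψ =>
      (fun ρ a' => Ψ ρ (Fin.castLE hm a')) ∈ S).card =
      (S ×ˢ (univ : Finset (Fin (k + 1) → {a : Fin m // ¬ (a : ℕ) < m'} → Fin k → Fin n × Bool))).card := by
    refine Finset.card_bij (fun Ψ _ => e Ψ) (fun Ψ hΨ => ?_) (fun Ψ₁ _ Ψ₂ _ h => e.injective h)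
      (fun x hx => ⟨e.symm x, ?_, e.apply_symm_apply x⟩)
    · rw [mem_filter] at hΨ
      rw [mem_product, he]
      exact ⟨hΨ.2, mem_univ _⟩
    · rw [mem_product] at hx
      rw [mem_filter]
      have h1 : (e (e.symm x)).1 = x.1 := by rw [e.apply_symm_apply]
      rw [he] at h1
      exact ⟨mem_univ _, by rw [h1]; exact hx.1⟩
  rw [hfil, card_product, card_univ, hcard]
  ring

/-- **The tail event at one splice point.** Fix `G` on `m'`-row instances, `m' ≤ m`, a segment `r`
and a splice index `q`; let `σ Ψ := G (head of the splice point (r, q) of Ψ)`.  The path tuples `Ψ`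
for which at least `2^{-k}·#A + t` of the non-straddling tail rows `a ∈ A` (`a ≥ m'`) of the splice
point are violated by `σ Ψ` number at most `exp(-t²/(2(m - m')))·#paths` (`t > 0`, `n ≥ 1`). -/
theorem sissDL_card_bad_le {k m m' n : ℕ} (hm : m' ≤ m) (hn : 1 ≤ n) (t : ℝ) (ht : 0 < t)
    (G : (Fin m' → Fin k → Fin n × Bool) → (Fin n → Bool)) (r : Fin k) (q : ℕ) :
    (((univ : Finset (Fin (k + 1) → Fin m → Fin k → Fin n × Bool)).filter fun Ψ =>
        (n : ℝ) ^ k / (2 * (n : ℝ)) ^ k *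
            ((univ : Finset (Fin m)).filter fun a : Fin m =>
              m' ≤ (a : ℕ) ∧ (((a : ℕ) + 1) * k ≤ q ∨ q ≤ (a : ℕ) * k)).card + t ≤
          ((((univ : Finset (Fin m)).filter fun a : Fin m =>
              m' ≤ (a : ℕ) ∧ (((a : ℕ) + 1) * k ≤ q ∨ q ≤ (a : ℕ) * k)).filter fun a : Fin m =>
            ∀ b : Fin k, G (fun (a' : Fin m') (b : Fin k) => if (a' : ℕ) * k + b < q
                then Ψ r.succ (Fin.castLE hm a') b else Ψ r.castSucc (Fin.castLE hm a') b)
              ((Ψ (if ((a : ℕ) + 1) * k ≤ q then r.succ else r.castSucc) a b).1) ≠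
              (Ψ (if ((a : ℕ) + 1) * k ≤ q then r.succ else r.castSucc) a b).2).card : ℝ)).card : ℝ)
      ≤ Real.exp (-(t ^ 2 / (2 * ((m - m' : ℕ) : ℝ)))) *
        Fintype.card (Fin (k + 1) → Fin m → Fin k → Fin n × Bool) := by
  set A := (univ : Finset (Fin m)).filter fun a : Fin m =>
      m' ≤ (a : ℕ) ∧ (((a : ℕ) + 1) * k ≤ q ∨ q ≤ (a : ℕ) * k) with hA
  set ρ : Fin m → Fin (k + 1) := fun a => if ((a : ℕ) + 1) * k ≤ q then r.succ else r.castSucc with hρ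
  set σ : (Fin (k + 1) → Fin m → Fin k → Fin n × Bool) → (Fin n → Bool) := fun Ψ =>
      G (fun (a' : Fin m') (b : Fin k) => if (a' : ℕ) * k + b < q
        then Ψ r.succ (Fin.castLE hm a') b else Ψ r.castSucc (Fin.castLE hm a') b) with hσ
  -- `σ` does not read the tail rows
  have hσinv : ∀ a ∈ A, ∀ (Ψ : Fin (k + 1) → Fin m → Fin k → Fin n × Bool) (c : Fin k → Fin n × Bool),
      σ (Function.update Ψ (ρ a) (Function.update (Ψ (ρ a)) a c)) = σ Ψ := by
    intro a ha Ψ c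
    rw [hA, mem_filter] at ha
    simp only [hσ]
    congr 1
    funext a' b
    have hne : Fin.castLE hm a' ≠ a := by
      intro h
      have h1 : ((Fin.castLE hm a' : Fin m) : ℕ) = a := by rw [h]
      have h2 : ((Fin.castLE hm a' : Fin m) : ℕ) < m' := a'.isLt
      omega
    rw [sissDL_update₂_apply_of_ne Ψ (ρ a) a c r.succ (Fin.castLE hm a') hne,
      sissDL_update₂_apply_of_ne Ψ (ρ a) a c r.castSucc (Fin.castLE hm a') hne]
  -- `#A ≤ m - m'`
  have hAle : A.card ≤ m - m' := by
    have hsub : A ⊆ (univ : Finset (Fin m)).filter fun a : Fin m => ¬ (a : ℕ) < m' := by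
      intro a ha
      rw [hA, mem_filter] at ha
      exact mem_filter.2 ⟨mem_univ _, not_lt.2 ha.2.1⟩
    refine (card_le_card hsub).trans (le_of_eq ?_)
    have h1 : ((univ : Finset (Fin m)).filter fun a : Fin m => (a : ℕ) < m').card = m' := by
      have himg : ((univ : Finset (Fin m)).filter fun a : Fin m => (a : ℕ) < m') =
          (univ : Finset (Fin m')).image (Fin.castLE hm) := by
        ext a
        simp only [mem_filter, mem_univ, true_and, mem_image]
        constructor
        · intro ha; exact ⟨⟨a, ha⟩, Fin.ext rfl⟩
        · rintro ⟨a', rfl⟩; exact a'.isLt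
      rw [himg, card_image_of_injective _ (Fin.castLE_injective hm), card_univ, Fintype.card_fin]
    have h2 := Finset.card_filter_add_card_filter_not (s := (univ : Finset (Fin m)))
      (fun a : Fin m => (a : ℕ) < m')
    rw [h1, card_univ, Fintype.card_fin] at h2
    omega
  rcases Nat.eq_zero_or_pos A.card with hA0 | hApos
  · -- no tail row: the event is empty
    have hempty : ((univ : Finset (Fin (k + 1) → Fin m → Fin k → Fin n × Bool)).filter fun Ψ =>
        (n : ℝ) ^ k / (2 * (n : ℝ)) ^ k * A.card + t ≤
          ((A.filter fun a => ∀ b : Fin k, σ Ψ ((Ψ (ρ a) a b).1) ≠ (Ψ (ρ a) a b).2).card : ℝ)) = ∅ := by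
      refine filter_eq_empty_iff.2 fun Ψ _ hle => ?_
      have hA' : A = ∅ := card_eq_zero.1 hA0
      rw [hA', filter_empty, card_empty, Nat.cast_zero, mul_zero, zero_add] at hle
      linarith
    have h0 : ((((univ : Finset (Fin (k + 1) → Fin m → Fin k → Fin n × Bool)).filter fun Ψ =>
        (n : ℝ) ^ k / (2 * (n : ℝ)) ^ k * A.card + t ≤
          ((A.filter fun a => ∀ b : Fin k, σ Ψ ((Ψ (ρ a) a b).1) ≠ (Ψ (ρ a) a b).2).card : ℝ)).card : ℕ) : ℝ)
          = 0 := by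
      rw [hempty, card_empty, Nat.cast_zero]
    refine (le_of_eq h0).trans ?_
    positivity
  · have hmain := sissDL_card_violTail_paths_le (k := k) hn A hApos ρ t ht.le σ hσinv
    refine hmain.trans (mul_le_mul_of_nonneg_right ?_ (Nat.cast_nonneg _))
    refine Real.exp_le_exp.2 (neg_le_neg ?_)
    have hAR : (0 : ℝ) < A.card := by exact_mod_cast hApos
    have hle : (A.card : ℝ) ≤ ((m - m' : ℕ) : ℝ) := by exact_mod_cast hAle
    have hM : (0 : ℝ) < ((m - m' : ℕ) : ℝ) := lt_of_lt_of_le hAR hle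
    rw [div_le_div_iff₀ (by positivity) (by positivity)]
    have : t ^ 2 * (2 * (A.card : ℝ)) ≤ t ^ 2 * (2 * ((m - m' : ℕ) : ℝ)) :=
      mul_le_mul_of_nonneg_left (by linarith) (by positivity)
    exact this

/-- At most `m - m'` non-straddling tail rows. -/
theorem sissDL_card_tailRows_le (hm : m' ≤ m) (q : ℕ) :
    ((univ : Finset (Fin m)).filter fun a : Fin m =>
      m' ≤ (a : ℕ) ∧ (((a : ℕ) + 1) * k ≤ q ∨ q ≤ (a : ℕ) * k)).card ≤ m - m' := by
  have hsub : ((univ : Finset (Fin m)).filter fun a : Fin m =>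
      m' ≤ (a : ℕ) ∧ (((a : ℕ) + 1) * k ≤ q ∨ q ≤ (a : ℕ) * k)) ⊆
      (univ : Finset (Fin m)).filter fun a : Fin m => ¬ (a : ℕ) < m' := by
    intro a ha
    rw [mem_filter] at ha
    exact mem_filter.2 ⟨mem_univ _, not_lt.2 ha.2.1⟩
  refine (card_le_card hsub).trans (le_of_eq ?_)
  have h1 : ((univ : Finset (Fin m)).filter fun a : Fin m => (a : ℕ) < m').card = m' := by
    have himg : ((univ : Finset (Fin m)).filter fun a : Fin m => (a : ℕ) < m') =
        (univ : Finset (Fin m')).image (Fin.castLE hm) := by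
      ext a
      simp only [mem_filter, mem_univ, true_and, mem_image]
      constructor
      · intro ha; exact ⟨⟨a, ha⟩, Fin.ext rfl⟩
      · rintro ⟨a', rfl⟩; exact a'.isLt
    rw [himg, card_image_of_injective _ (Fin.castLE_injective hm), card_univ, Fintype.card_fin]
  have h2 := Finset.card_filter_add_card_filter_not (s := (univ : Finset (Fin m)))
    (fun a : Fin m => (a : ℕ) < m')
  rw [h1, card_univ, Fintype.card_fin] at h2
  omega

/-- **Validity of the lifted section at one splice point, off the tail event.** If the head of the
splice point `(r, q)` has at most `V'` rows violated by `σ := G (head)` and fewer than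
`2^{-k}·#A + t` of the non-straddling tail rows `A` are violated by `σ`, then the splice point has at
most `V' + 1 + 2^{-k}(m - m') + t` rows violated by `σ`. -/
theorem sissDL_viol_le (hm : m' ≤ m) (V' t : ℝ) (G : (Fin m' → Fin k → Fin n × Bool) → (Fin n → Bool))
    (Ψ : Fin (k + 1) → Fin m → Fin k → Fin n × Bool) (r : Fin k) (q : ℕ)
    (hhead : (((univ : Finset (Fin m')).filter fun i' : Fin m' => ∀ j : Fin k,
        G (fun (a' : Fin m') (b : Fin k) => if (a' : ℕ) * k + b < q
            then Ψ r.succ (Fin.castLE hm a') b else Ψ r.castSucc (Fin.castLE hm a') b)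
          ((if (i' : ℕ) * k + j < q then Ψ r.succ (Fin.castLE hm i') j
            else Ψ r.castSucc (Fin.castLE hm i') j).1) ≠
          (if (i' : ℕ) * k + j < q then Ψ r.succ (Fin.castLE hm i') j
            else Ψ r.castSucc (Fin.castLE hm i') j).2).card : ℝ) ≤ V')
    (hgood : ¬ ((n : ℝ) ^ k / (2 * (n : ℝ)) ^ k *
            ((univ : Finset (Fin m)).filter fun a : Fin m =>
              m' ≤ (a : ℕ) ∧ (((a : ℕ) + 1) * k ≤ q ∨ q ≤ (a : ℕ) * k)).card + t ≤
          ((((univ : Finset (Fin m)).filter fun a : Fin m =>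
              m' ≤ (a : ℕ) ∧ (((a : ℕ) + 1) * k ≤ q ∨ q ≤ (a : ℕ) * k)).filter fun a : Fin m =>
            ∀ b : Fin k, G (fun (a' : Fin m') (b : Fin k) => if (a' : ℕ) * k + b < q
                then Ψ r.succ (Fin.castLE hm a') b else Ψ r.castSucc (Fin.castLE hm a') b)
              ((Ψ (if ((a : ℕ) + 1) * k ≤ q then r.succ else r.castSucc) a b).1) ≠
              (Ψ (if ((a : ℕ) + 1) * k ≤ q then r.succ else r.castSucc) a b).2).card : ℝ))) :
    (((univ : Finset (Fin m)).filter fun i : Fin m => ∀ j : Fin k,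
        G (fun (a' : Fin m') (b : Fin k) => if (a' : ℕ) * k + b < q
            then Ψ r.succ (Fin.castLE hm a') b else Ψ r.castSucc (Fin.castLE hm a') b)
          ((if (i : ℕ) * k + j < q then Ψ r.succ i j else Ψ r.castSucc i j).1) ≠
          (if (i : ℕ) * k + j < q then Ψ r.succ i j else Ψ r.castSucc i j).2).card : ℝ)
      ≤ V' + 1 + (n : ℝ) ^ k / (2 * (n : ℝ)) ^ k * ((m - m' : ℕ) : ℝ) + t := by
  set σ : Fin n → Bool := G (fun (a' : Fin m') (b : Fin k) => if (a' : ℕ) * k + b < q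
      then Ψ r.succ (Fin.castLE hm a') b else Ψ r.castSucc (Fin.castLE hm a') b) with hσ
  set p : ℝ := (n : ℝ) ^ k / (2 * (n : ℝ)) ^ k with hp
  set A := (univ : Finset (Fin m)).filter fun a : Fin m =>
      m' ≤ (a : ℕ) ∧ (((a : ℕ) + 1) * k ≤ q ∨ q ≤ (a : ℕ) * k) with hA
  set S := (univ : Finset (Fin m)).filter fun i : Fin m => ∀ j : Fin k,
      σ ((if (i : ℕ) * k + j < q then Ψ r.succ i j else Ψ r.castSucc i j).1) ≠
        (if (i : ℕ) * k + j < q then Ψ r.succ i j else Ψ r.castSucc i j).2 with hS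
  set S₁ := (univ : Finset (Fin m)).filter fun i : Fin m => (i : ℕ) < m' ∧ ∀ j : Fin k,
      σ ((if (i : ℕ) * k + j < q then Ψ r.succ i j else Ψ r.castSucc i j).1) ≠
        (if (i : ℕ) * k + j < q then Ψ r.succ i j else Ψ r.castSucc i j).2 with hS₁
  set S₁' := (univ : Finset (Fin m')).filter fun i' : Fin m' => ∀ j : Fin k,
      σ ((if (i' : ℕ) * k + j < q then Ψ r.succ (Fin.castLE hm i') j
            else Ψ r.castSucc (Fin.castLE hm i') j).1) ≠
          (if (i' : ℕ) * k + j < q then Ψ r.succ (Fin.castLE hm i') j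
            else Ψ r.castSucc (Fin.castLE hm i') j).2 with hS₁'
  set S₂ := A.filter fun a : Fin m =>
      ∀ b : Fin k, σ ((Ψ (if ((a : ℕ) + 1) * k ≤ q then r.succ else r.castSucc) a b).1) ≠
        (Ψ (if ((a : ℕ) + 1) * k ≤ q then r.succ else r.castSucc) a b).2 with hS₂
  set S₃ := (univ : Finset (Fin m)).filter fun a : Fin m =>
      ¬ (((a : ℕ) + 1) * k ≤ q ∨ q ≤ (a : ℕ) * k) with hS₃
  -- the decomposition of the violated rows
  have hsub : S ⊆ S₁ ∪ (S₂ ∪ S₃) := by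
    intro i hi
    rw [hS, mem_filter] at hi
    rw [mem_union, mem_union]
    by_cases h1 : (i : ℕ) < m'
    · exact Or.inl (by rw [hS₁, mem_filter]; exact ⟨mem_univ _, h1, hi.2⟩)
    · by_cases h2 : ((i : ℕ) + 1) * k ≤ q ∨ q ≤ (i : ℕ) * k
      · refine Or.inr (Or.inl ?_)
        rw [hS₂, mem_filter]
        refine ⟨by rw [hA, mem_filter]; exact ⟨mem_univ _, not_lt.1 h1, h2⟩, ?_⟩
        have hrow := sissDL_splice_row Ψ r q i h2
        intro b
        have hb := hi.2 b
        have e : (if (i : ℕ) * k + b < q then Ψ r.succ i b else Ψ r.castSucc i b) =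
            Ψ (if ((i : ℕ) + 1) * k ≤ q then r.succ else r.castSucc) i b :=
          congrFun hrow b
        rw [e] at hb
        exact hb
      · exact Or.inr (Or.inr (by rw [hS₃, mem_filter]; exact ⟨mem_univ _, h2⟩))
  -- the head rows
  have hS₁card : S₁.card = S₁'.card := by
    have himg : S₁ = S₁'.image (Fin.castLE hm) := by
      ext i
      rw [hS₁, mem_filter, mem_image]
      constructor
      · rintro ⟨_, hi, hv⟩
        refine ⟨⟨i, hi⟩, ?_, Fin.ext rfl⟩
        rw [hS₁', mem_filter]
        exact ⟨mem_univ _, hv⟩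
      · rintro ⟨i', hi', rfl⟩
        rw [hS₁', mem_filter] at hi'
        exact ⟨mem_univ _, i'.isLt, hi'.2⟩
    rw [himg, card_image_of_injective _ (Fin.castLE_injective hm)]
  have h1 : (S₁.card : ℝ) ≤ V' := by rw [hS₁card]; exact hhead
  have h2 : (S₂.card : ℝ) < p * A.card + t := not_le.1 hgood
  have h3 : (S₃.card : ℝ) ≤ 1 := by
    have := sissDL_card_straddle_le_one (m := m) (k := k) q
    exact_mod_cast this
  have hAle : (A.card : ℝ) ≤ ((m - m' : ℕ) : ℝ) := by
    exact_mod_cast sissDL_card_tailRows_le (k := k) hm q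
  have hp0 : 0 ≤ p := by rw [hp]; positivity
  have hcard : S.card ≤ S₁.card + (S₂.card + S₃.card) :=
    (card_le_card hsub).trans ((card_union_le _ _).trans
      (Nat.add_le_add_left (card_union_le _ _) _))
  have hcardR : (S.card : ℝ) ≤ S₁.card + (S₂.card + S₃.card) := by exact_mod_cast hcard
  have hpA : p * A.card ≤ p * ((m - m' : ℕ) : ℝ) := mul_le_mul_of_nonneg_left hAle hp0
  linarith

end DensityLiftPath

end Summit.PneNP.PneNP.Theorems
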